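import Literature.NumberTheory.Automorphic.ReductionTheoryGLnSiegelProperty
import Literature.NumberTheory.Automorphic.SiegelMultiplicity
import Literature.NumberTheory.Automorphic.SiegelSetInverse
import Mathlib.Tactic.Group
import HarnessLib

/-!
# The Siegel property of Siegel sets in `GL_n(𝔸_K)` — proof
(Godement, *Domaines fondamentaux des groupes arithmétiques*, Sém. Bourbaki 257 (1962/63), §10,
Théorème 9 (Borel) with Lemmes 1–4; English translation in Borel–Godement–Siegel–Weil,
*Arithmetic groups and reduction theory* (2020), PDF pp. 169–173 of the held copy)

Sibling proof file of `ReductionTheoryGLnSiegelProperty`, discharging its named fact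
`siegelFiniteness_gl n K` (Borel's Siegel property for `GL_n` over a number field `K`): for any two
Siegel sets `S = Ω A_{T₀}(t) K`, `S' = Ω' A_{T₀}(t') K` in `GL_n(𝔸_K)` only finitely many rational
`γ ∈ GL_n(K)` satisfy `γ A_G S ∩ S' ≠ ∅`. The statement of the fact is untouched; users holding
`(h : siegelFiniteness_gl n K)` are fed `siegelFiniteness_gl_holds n K`.

## The proof (Godement's Lemmes 1–4 made explicit for `GL_n`)

Let `γ z ω a k = ω' a' k'` (`γ` rational, `z ∈ A_G`, `ω ∈ Ω`, `ω' ∈ Ω'`, `a, a'` in the cones,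
`k, k' ∈ K`).

1. *Lemme 1 (conjugation by the cone).* `γ = a' ψ (z a)⁻¹` with
   `ψ = (a'⁻¹ ω' a') (k' k⁻¹) (a⁻¹ ω⁻¹ a)` in a fixed compact set `Ψ`
   (`exists_isCompact_conj_siegelCone_mem_of_subset`: conjugating a compact subset of `B(𝔸_K)` by
   the cone keeps it bounded).
2. *Lemmes 2–3 (heights of rational entries).* The entries `γ_{ij} = (a'_i/(za)_j, 1) · ψ_{ij}`
   are principal adeles with finite part in a fixed compact set, so they vanish as soon as
   `a'_i / (za)_j ≤ ε` (product formula, `exists_pos_forall_apply_eq_zero_of_map_eq_twoTorus`), and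
   likewise for `γ⁻¹ = (za) ψ⁻¹ a'⁻¹`. As `det γ ≠ 0`, some permutation pattern of entries of `γ`
   survives (`exists_perm_forall_apply_ne_zero`), and a pigeonhole along the cone
   (`siegelCone_le_of_perm_dominates`) yields `ε t₀^{2n} (za)_i ≤ a'_i ≤ (ε t₀^{2n})⁻¹ (za)_i`:
   the torus components agree up to a compact set, `γ = a ψ₁ a⁻¹` with `ψ₁ ∈ Ψ₁` compact.
3. *Lemme 3/4 (the parabolic).* Group the indices of `a` by its large gaps (`gapLabel` of
   `SiegelMultiplicity`); the contraction lemma of `RationalPointsConeConjugates` puts `γ` in the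
   standard parabolic `P_c(K)`, hence `k' k⁻¹ ∈ K ∩ P_c(𝔸_K)`.
4. *`M_∞` adapted to `T` (Godement's closing argument).* The archimedean part of `k' k⁻¹` is
   unitary and block triangular, hence block diagonal
   (`apply_eq_zero_of_star_mul_self_of_blockTriangular_ne`), so its conjugate by `a` stays in a
   compact set `T_c` (in-block ratios of `a` are bounded); its finite part commutes with the
   archimedean torus (`posRealDiagonal_mul_mul_inv_eq_of_mem_glIntegralLevel`). Therefore
   `γ ∈ Ω̄' · D · T_c · ({1} × GL_n(𝒪̂_K)) · Ω̄⁻¹`, a compact set, for one of finitely many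
   labellings `c`, and `GL_n(K)` is discrete in `GL_n(𝔸_K)` (`gl_isDiscreteRational_holds`).

No Bruhat decomposition and no exterior powers are needed in this `GL_n`-specific arrangement.
Everything here is proved; theorems only.

## References

* R. Godement, *Domaines fondamentaux des groupes arithmétiques*, Sém. Bourbaki 257 (1962/63),
  §10, Théorème 9 (Borel) and Lemmes 1–4; English translation in A. Borel, R. Godement,
  C. L. Siegel, A. Weil, *Arithmetic groups and reduction theory*, ed. L. Ji (2020), PDF
  pp. 169–173 of the held copy [BorelEtAl2020].
* A. Borel, *Some finiteness properties of adele groups over number fields*, Publ. Math. IHÉS 16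
  (1963), §5 [Borel1963].
-/

noncomputable section

open scoped NNReal MatrixGroups Pointwise Classical
open NumberField IsDedekindDomain Set Filter

namespace Literature.NumberTheory.Automorphic

variable {n : ℕ} {K : Type} [Field K] [NumberField K]

/-! ### Two-torus conjugates `diag(a) ψ diag(b)⁻¹`: entries, and vanishing of contracted rational entries -/

/-- **Entries of `diag(a) ψ diag(b)⁻¹`.** For positive real diagonal matrices `diag(a)`, `diag(b)`
(`posRealDiagonal`) and any adelic matrix `ψ`, the `(i, j)` entry of `diag(a) ψ diag(b)⁻¹` is
`(a_i / b_j, 1) · ψ_{ij}`, the real scalar acting on the archimedean components only (the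
two-torus version of `coe_posRealDiagonal_mul_mul_inv_apply`). [folklore] -/
theorem coe_posRealDiagonal_mul_mul_posRealDiagonal_inv_apply (a b : Fin n → ℝ≥0ˣ)
    (ψ : GL (Fin n) (AdeleRing (𝓞 K) K)) (i j : Fin n) :
    ((posRealDiagonal n K a * ψ * (posRealDiagonal n K b)⁻¹ : GL (Fin n) (AdeleRing (𝓞 K) K)) :
        Matrix (Fin n) (Fin n) (AdeleRing (𝓞 K) K)) i j =
      realAdele K (((a i : ℝ≥0) : ℝ) / ((b j : ℝ≥0) : ℝ)) *
        (ψ : Matrix (Fin n) (Fin n) (AdeleRing (𝓞 K) K)) i j := by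
  rw [← map_inv, Units.val_mul, Units.val_mul, coe_posRealDiagonal, coe_posRealDiagonal,
    Matrix.mul_diagonal, Matrix.diagonal_mul, Pi.inv_apply, map_inv, mul_right_comm,
    ← Units.val_mul, ← map_inv, ← map_mul, coe_posRealIdele]
  congr 2
  rw [Units.val_mul, Units.val_inv_eq_inv_val, NNReal.coe_mul, NNReal.coe_inv, div_eq_mul_inv]

/-- **Contracted entries of rational points of the form `diag(a) ψ diag(b)⁻¹` vanish.** For every
compact `Ψ ⊆ GL_n(𝔸_K)` there is `ε > 0` such that: if `γ ∈ GL_n(K)` has diagonal image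
`diag(a) ψ diag(b)⁻¹` with `ψ ∈ Ψ` and `a, b` positive real, then `γ_{ij} = 0` whenever
`a_i / b_j ≤ ε` — the principal adele `γ_{ij} = (a_i/b_j, 1) · ψ_{ij}` has finite part in a fixed
compact set and archimedean part `≤ ε ×` bounded, hence vanishes by the product formula
(`exists_nhds_forall_algebraMap_eq_zero`, `exists_pos_forall_sum_realToInfiniteAdele_mul_mem`).
This is `exists_pos_forall_apply_eq_zero_of_map_eq_conj` (`RationalPointsConeConjugates`) with two
different torus elements, same proof; it is the entrywise mechanism of Godement's Lemme 2–3 in the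
proof of Borel's Siegel property. [cite: BorelEtAl2020, Godement Sém. Bourbaki 257 §10 Lemme 3 (PDF p. 171)] -/
theorem exists_pos_forall_apply_eq_zero_of_map_eq_twoTorus
    {Ψ : Set (GL (Fin n) (AdeleRing (𝓞 K) K))} (hΨ : IsCompact Ψ) :
    ∃ ε : ℝ, 0 < ε ∧ ∀ (a b : Fin n → ℝ≥0ˣ) (γ : GL (Fin n) K), ∀ ψ ∈ Ψ,
      Matrix.GeneralLinearGroup.map (algebraMap K (AdeleRing (𝓞 K) K)) γ =
          posRealDiagonal n K a * ψ * (posRealDiagonal n K b)⁻¹ →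
        ∀ i j : Fin n, ((a i : ℝ≥0) : ℝ) / ((b j : ℝ≥0) : ℝ) ≤ ε →
          (γ : Matrix (Fin n) (Fin n) K) i j = 0 := by
  have hval : Continuous fun ω : GL (Fin n) (AdeleRing (𝓞 K) K) =>
      (ω : Matrix (Fin n) (Fin n) (AdeleRing (𝓞 K) K)) := Units.continuous_val
  have hcont : ∀ i j : Fin n, Continuous fun ω : GL (Fin n) (AdeleRing (𝓞 K) K) =>
      (ω : Matrix (Fin n) (Fin n) (AdeleRing (𝓞 K) K)) i j := fun i j => hval.matrix_elem i j
  set Bf : Set (FiniteAdeleRing (𝓞 K) K) :=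
    ⋃ i : Fin n, ⋃ j : Fin n, (fun ω : GL (Fin n) (AdeleRing (𝓞 K) K) =>
      ((ω : Matrix (Fin n) (Fin n) (AdeleRing (𝓞 K) K)) i j).2) '' Ψ with hBf
  set Bi : Set (InfiniteAdeleRing K) :=
    ⋃ i : Fin n, ⋃ j : Fin n, (fun ω : GL (Fin n) (AdeleRing (𝓞 K) K) =>
      ((ω : Matrix (Fin n) (Fin n) (AdeleRing (𝓞 K) K)) i j).1) '' Ψ with hBi
  have hBfc : IsCompact Bf :=
    isCompact_iUnion fun i => isCompact_iUnion fun j =>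
      hΨ.image (continuous_snd.comp (hcont i j))
  have hBic : IsCompact Bi :=
    isCompact_iUnion fun i => isCompact_iUnion fun j =>
      hΨ.image (continuous_fst.comp (hcont i j))
  obtain ⟨W, hW, hWzero⟩ := exists_nhds_forall_algebraMap_eq_zero (K := K) hBfc
  obtain ⟨ε, hε, hεW⟩ := exists_pos_forall_sum_realToInfiniteAdele_mul_mem (K := K) hW hBic 1
  refine ⟨ε, hε, fun a b γ ψ hψ hγ i j hij => ?_⟩
  have hentry : algebraMap K (AdeleRing (𝓞 K) K) ((γ : Matrix (Fin n) (Fin n) K) i j) =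
      realAdele K (((a i : ℝ≥0) : ℝ) / ((b j : ℝ≥0) : ℝ)) *
        (ψ : Matrix (Fin n) (Fin n) (AdeleRing (𝓞 K) K)) i j := by
    have h : ((Matrix.GeneralLinearGroup.map (algebraMap K (AdeleRing (𝓞 K) K)) γ :
        GL (Fin n) (AdeleRing (𝓞 K) K)) : Matrix (Fin n) (Fin n) (AdeleRing (𝓞 K) K)) i j =
        ((posRealDiagonal n K a * ψ * (posRealDiagonal n K b)⁻¹ : GL (Fin n) (AdeleRing (𝓞 K) K)) :
          Matrix (Fin n) (Fin n) (AdeleRing (𝓞 K) K)) i j := by rw [hγ]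
    rw [coe_posRealDiagonal_mul_mul_posRealDiagonal_inv_apply, Matrix.GeneralLinearGroup.map_apply] at h
    exact h
  refine hWzero _ ?_ ?_
  · rw [hentry, (realAdele_mul_fst_snd _ _).2]
    exact mem_iUnion.2 ⟨i, mem_iUnion.2 ⟨j, mem_image_of_mem _ hψ⟩⟩
  · rw [hentry, (realAdele_mul_fst_snd _ _).1]
    have h := hεW (fun _ => ((a i : ℝ≥0) : ℝ) / ((b j : ℝ≥0) : ℝ))
      (fun _ => ((ψ : Matrix (Fin n) (Fin n) (AdeleRing (𝓞 K) K)) i j).1)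
      (fun _ => by rw [abs_of_nonneg (by positivity)]; exact hij)
      (fun _ => mem_iUnion.2 ⟨i, mem_iUnion.2 ⟨j, mem_image_of_mem _ hψ⟩⟩)
    simpa using h

/-! ### Invertible matrices have a non-vanishing permutation pattern -/

/-- An invertible matrix over a field has a permutation `σ` with all entries `γ_{σ(i) i} ≠ 0`
(otherwise every term of the Leibniz expansion of `det γ` vanishes). [folklore] -/
theorem exists_perm_forall_apply_ne_zero {F : Type*} [Field F] (γ : GL (Fin n) F) :
    ∃ σ : Equiv.Perm (Fin n), ∀ i, (γ : Matrix (Fin n) (Fin n) F) (σ i) i ≠ 0 := by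
  by_contra h
  push Not at h
  have hdet : (γ : Matrix (Fin n) (Fin n) F).det = 0 := by
    rw [Matrix.det_apply]
    refine Finset.sum_eq_zero fun σ _ => ?_
    obtain ⟨i, hi⟩ := h σ
    have hp : ∏ k, (γ : Matrix (Fin n) (Fin n) F) (σ k) k = 0 :=
      Finset.prod_eq_zero (Finset.mem_univ i) hi
    rw [hp, smul_zero]
  refine (Matrix.GeneralLinearGroup.det γ).ne_zero ?_
  rw [Matrix.GeneralLinearGroup.val_det_apply]
  exact hdet

/-! ### Comparison of two cone elements dominating each other along a permutation -/

/-- **Pigeonhole on the Siegel cone.** Let `x`, `y` satisfy the simple-root inequalities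
`t x_{l+1} ≤ x_l`, `t y_{l+1} ≤ y_l` (`0 < t ≤ 1`) and suppose `ε y_i ≤ x_{σ(i)}` for all `i` and
some permutation `σ`. Then `ε t^{2n} y_j ≤ x_j` for every `j`: among the `j + 1` indices `m ≤ j`
some `m` has `σ(m) ≥ j` (pigeonhole), and then `x_j ≥ tⁿ x_{σ(m)} ≥ tⁿ ε y_m ≥ tⁿ ε tⁿ y_j`.
[folklore] -/
theorem siegelCone_le_of_perm_dominates {t ε : ℝ} (ht : 0 < t) (ht1 : t ≤ 1) (hε : 0 ≤ ε)
    {x y : Fin n → ℝ≥0ˣ}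
    (hx : ∀ i j : Fin n, (j : ℕ) = (i : ℕ) + 1 → t * ((x j : ℝ≥0) : ℝ) ≤ ((x i : ℝ≥0) : ℝ))
    (hy : ∀ i j : Fin n, (j : ℕ) = (i : ℕ) + 1 → t * ((y j : ℝ≥0) : ℝ) ≤ ((y i : ℝ≥0) : ℝ))
    (σ : Equiv.Perm (Fin n)) (h : ∀ i, ε * ((y i : ℝ≥0) : ℝ) ≤ ((x (σ i) : ℝ≥0) : ℝ))
    (j : Fin n) :
    ε * (t ^ n * t ^ n) * ((y j : ℝ≥0) : ℝ) ≤ ((x j : ℝ≥0) : ℝ) := by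
  -- pigeonhole: some `m ≤ j` has `j ≤ σ m`
  obtain ⟨m, hmj, hjm⟩ : ∃ m : Fin n, m ≤ j ∧ j ≤ σ m := by
    by_contra hno
    push Not at hno
    have hmaps : Set.MapsTo σ ((Finset.Iic j : Finset (Fin n)) : Set (Fin n))
        ((Finset.Iio j : Finset (Fin n)) : Set (Fin n)) := by
      intro m hm
      rw [Finset.coe_Iic, Set.mem_Iic] at hm
      rw [Finset.coe_Iio, Set.mem_Iio]
      exact hno m hm
    have hcard := Finset.card_le_card_of_injOn σ hmaps σ.injective.injOn
    rw [Fin.card_Iic, Fin.card_Iio] at hcard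
    omega
  have htn : 0 < t ^ n := pow_pos ht n
  have h1 : t ^ n * ((x (σ m) : ℝ≥0) : ℝ) ≤ ((x j : ℝ≥0) : ℝ) := by
    have h' := apply_le_inv_pow_mul_of_le ht ht1 hx (Fin.le_def.1 hjm)
    rw [inv_pow, ← div_eq_inv_mul, le_div_iff₀ htn, mul_comm] at h'
    exact h'
  have h2 : t ^ n * ((y j : ℝ≥0) : ℝ) ≤ ((y m : ℝ≥0) : ℝ) := by
    have h' := apply_le_inv_pow_mul_of_le ht ht1 hy (Fin.le_def.1 hmj)
    rw [inv_pow, ← div_eq_inv_mul, le_div_iff₀ htn, mul_comm] at h'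
    exact h'
  calc ε * (t ^ n * t ^ n) * ((y j : ℝ≥0) : ℝ) = t ^ n * (ε * (t ^ n * ((y j : ℝ≥0) : ℝ))) := by ring
    _ ≤ t ^ n * (ε * ((y m : ℝ≥0) : ℝ)) :=
        mul_le_mul_of_nonneg_left (mul_le_mul_of_nonneg_left h2 hε) htn.le
    _ ≤ t ^ n * ((x (σ m) : ℝ≥0) : ℝ) := mul_le_mul_of_nonneg_left (h m) htn.le
    _ ≤ ((x j : ℝ≥0) : ℝ) := h1


/-! ### Unitary block triangular matrices are block diagonal -/

/-- **A block upper triangular unitary matrix is block diagonal** (over any commutative star ring):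
if `g ∈ GL_N(A)` satisfies `g* g = 1` and is block triangular for the labelling `b`, then
`g⁻¹ = g*` is block triangular as well, so the entries of `g` above the block diagonal vanish
too. For `GL_n` this is the fact that a maximal compact subgroup adapted to the diagonal torus
meets a standard parabolic subgroup inside its Levi factor (`M_∞ ∩ Q_∞ ⊆ H_∞`, the last step of
Godement's proof of Borel's Siegel property). [folklore] -/
theorem apply_eq_zero_of_star_mul_self_of_blockTriangular_ne {N : Type*} [Fintype N]
    [DecidableEq N] {α : Type*} [LinearOrder α] {A : Type*} [CommRing A] [StarRing A]
    {g : GL N A} (b : N → α) (hu : star (g : Matrix N N A) * g = 1)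
    (hT : (g : Matrix N N A).BlockTriangular b) {i j : N} (hij : b i ≠ b j) :
    (g : Matrix N N A) i j = 0 := by
  rcases lt_or_gt_of_ne hij with h | h
  · have hinv : ((g : Matrix N N A))⁻¹.BlockTriangular b :=
      Matrix.blockTriangular_inv_of_blockTriangular hT
    have hstar : star (g : Matrix N N A) = (g : Matrix N N A)⁻¹ :=
      (Matrix.inv_eq_left_inv hu).symm
    have h1 : ((g : Matrix N N A))⁻¹ j i = 0 := hinv h
    rw [← hstar, Matrix.star_apply] at h1
    simpa using congrArg star h1
  · exact hT h

/-! ### The Borel subgroup lies in every standard parabolic with monotone labelling -/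

/-- An upper triangular matrix is block upper triangular for every monotone block labelling.
[folklore] -/
theorem blockTriangular_of_blockTriangular_id_of_monotone {R : Type*} [Zero R] {α : Type*}
    [Preorder α] {M : Matrix (Fin n) (Fin n) R} (hM : M.BlockTriangular id) {c : Fin n → α}
    (hc : Monotone c) : M.BlockTriangular c := by
  intro i j hij
  have hji : j < i := by
    by_contra h'
    exact not_lt_of_ge (hc (not_lt.1 h')) hij
  exact hM hji

/-! ### Positive real diagonal matrices commute with the integral level -/

/-- **Archimedean torus elements commute with `{1} × GL_n(𝒪̂_K)`**: for `g` in the integral level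
(`glIntegralLevel`: archimedean component `1`) and any positive real diagonal `diag(e)`
(archimedean, finite components `1`), `diag(e) g diag(e)⁻¹ = g`. This is the observation "as `t'`
is equal to `1` at every finite place …" closing Godement's proof of Théorème 9. [folklore] -/
theorem posRealDiagonal_mul_mul_inv_eq_of_mem_glIntegralLevel (e : Fin n → ℝ≥0ˣ)
    {g : GL (Fin n) (AdeleRing (𝓞 K) K)} (hg : g ∈ glIntegralLevel n K) :
    posRealDiagonal n K e * g * (posRealDiagonal n K e)⁻¹ = g := by
  refine Matrix.GeneralLinearGroup.ext fun i j => ?_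
  rw [coe_posRealDiagonal_mul_mul_inv_apply]
  by_cases hij : i = j
  · subst hij
    rw [div_self (NNReal.coe_pos.2 (pos_iff_ne_zero.2 (e i).ne_zero)).ne', realAdele_one, one_mul]
  · obtain ⟨-, h1⟩ := mem_glIntegralLevel_iff'.1 hg
    refine Prod.ext ?_ ?_
    · rw [(realAdele_mul_fst_snd _ _).1, h1 i j, Matrix.one_apply_ne hij, mul_zero]
    · rw [(realAdele_mul_fst_snd _ _).2]

/-! ### Elements of `K` in a standard parabolic: archimedean part block diagonal -/

/-- **An element of `K = K_∞ · GL_n(𝒪̂_K)` lying in a standard parabolic `P_c(𝔸_K)` has block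
diagonal archimedean part.** Write `κ = (g, 1) · k₂` with `g ∈ K_∞ = U(n, K_∞)` and `k₂` in the
integral level; the archimedean entries of `κ` are those of `g`, so `g` is unitary and block
triangular, hence block diagonal (`apply_eq_zero_of_star_mul_self_of_blockTriangular_ne`), and so
is `g⁻¹ = g*`: the entries of `(g, 1)` and `(g, 1)⁻¹` off the blocks of `c` vanish. [folklore] -/
theorem exists_ofInfinite_mul_of_mem_standardParabolicGL {α : Type*} [LinearOrder α]
    (c : Fin n → α) {κ : GL (Fin n) (AdeleRing (𝓞 K) K)}
    (hκK : κ ∈ standardMaximalCompactGL n K)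
    (hκP : κ ∈ standardParabolicGL (AdeleRing (𝓞 K) K) c) :
    ∃ g ∈ Kinf n K, ∃ k₂ ∈ glIntegralLevel n K, κ = GLn.ofInfinite n K g * k₂ ∧
      (∀ i j : Fin n, c i ≠ c j →
        ((GLn.ofInfinite n K g : GL (Fin n) (AdeleRing (𝓞 K) K)) :
          Matrix (Fin n) (Fin n) (AdeleRing (𝓞 K) K)) i j = 0) ∧
      (∀ i j : Fin n, c i ≠ c j →
        (((GLn.ofInfinite n K g)⁻¹ : GL (Fin n) (AdeleRing (𝓞 K) K)) :
          Matrix (Fin n) (Fin n) (AdeleRing (𝓞 K) K)) i j = 0) := by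
  set φ := InfiniteAdeleRing.ringEquiv_mixedSpace K with hφ
  have hmem : κ ∈ (standardMaximalCompactGL n K : Set (GL (Fin n) (AdeleRing (𝓞 K) K))) := hκK
  rw [coe_standardMaximalCompactGL_eq_mul] at hmem
  obtain ⟨k₁, hk₁, k₂, hk₂, hk⟩ := hmem
  obtain ⟨g, hg, rfl⟩ := Subgroup.mem_map.1 hk₁
  -- archimedean entries of `κ` are those of `g`
  have hA : GLn.fstHom n K κ = (GLn.infiniteEquivMixed n K).symm g := by
    rw [← hk, map_mul, GLn.fstHom_ofInfinite, (mem_glIntegralLevel_iff.1 hk₂).2, mul_one]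
  have hent : ∀ a b : Fin n, ((κ : Matrix (Fin n) (Fin n) (AdeleRing (𝓞 K) K)) a b).1 =
      φ.symm ((g : Matrix (Fin n) (Fin n) (mixedEmbedding.mixedSpace K)) a b) := by
    intro a b
    change ((GLn.fstHom n K κ : GL (Fin n) (InfiniteAdeleRing K)) :
      Matrix (Fin n) (Fin n) (InfiniteAdeleRing K)) a b = _
    rw [hA]
    rfl
  -- `g` is unitary and block triangular, hence block diagonal, and so is `g⁻¹ = g*`
  have hgu : star (g : Matrix (Fin n) (Fin n) (mixedEmbedding.mixedSpace K)) * g = 1 := by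
    rw [Kinf_eq_unitarySubgroupGL] at hg
    exact (mem_unitarySubgroupGL_iff g).1 hg
  have hgT : (g : Matrix (Fin n) (Fin n) (mixedEmbedding.mixedSpace K)).BlockTriangular c := by
    intro a b hba
    have h0 : ((κ : Matrix (Fin n) (Fin n) (AdeleRing (𝓞 K) K)) a b).1 = 0 := by
      rw [(mem_standardParabolicGL_iff c κ).1 hκP hba]; rfl
    rw [hent] at h0
    simpa using congrArg φ h0
  have hg0 : ∀ a b : Fin n, c a ≠ c b →
      (g : Matrix (Fin n) (Fin n) (mixedEmbedding.mixedSpace K)) a b = 0 :=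
    fun a b hab => apply_eq_zero_of_star_mul_self_of_blockTriangular_ne c hgu hgT hab
  have hginv0 : ∀ a b : Fin n, c a ≠ c b →
      (((g⁻¹ : GL (Fin n) (mixedEmbedding.mixedSpace K)) :
        Matrix (Fin n) (Fin n) (mixedEmbedding.mixedSpace K))) a b = 0 := by
    intro a b hab
    have hstar : (((g⁻¹ : GL (Fin n) (mixedEmbedding.mixedSpace K)) :
        Matrix (Fin n) (Fin n) (mixedEmbedding.mixedSpace K))) =
        star (g : Matrix (Fin n) (Fin n) (mixedEmbedding.mixedSpace K)) := by
      rw [Matrix.coe_units_inv, Matrix.inv_eq_left_inv hgu]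
    rw [hstar, Matrix.star_apply, hg0 b a (Ne.symm hab), star_zero]
  refine ⟨g, hg, k₂, hk₂, hk.symm, fun i j hij => ?_, fun i j hij => ?_⟩
  · rw [GLn.coe_ofInfinite_apply, hg0 i j hij, map_zero,
      Matrix.one_apply_ne (fun h => hij (congrArg c h))]
    rfl
  · rw [← map_inv, GLn.coe_ofInfinite_apply, hginv0 i j hij, map_zero,
      Matrix.one_apply_ne (fun h => hij (congrArg c h))]
    rfl


/-! ### The Siegel property -/

/-- `𝔸_K` is Hausdorff (private copy; the instance is assembled from Mathlib's instances on the
factors, as in `ReductionTheoryGLnConjugation`). [folklore] -/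
private theorem t2Space_adeleRing_aux : T2Space (AdeleRing (𝓞 K) K) := by
  haveI : T2Space (FiniteAdeleRing (𝓞 K) K) := inferInstanceAs <| T2Space
    (RestrictedProduct (fun w : HeightOneSpectrum (𝓞 K) => w.adicCompletion K)
      (fun w => (w.adicCompletionIntegers K : Set (w.adicCompletion K))) Filter.cofinite)
  haveI : T2Space (InfiniteAdeleRing K) :=
    inferInstanceAs <| T2Space ((w : InfinitePlace K) → w.Completion)
  exact inferInstanceAs <| T2Space (InfiniteAdeleRing K × FiniteAdeleRing (𝓞 K) K)

/-- A compact set of `GL_n(𝔸_K)` containing all positive real diagonal matrices `diag(e)` with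
`L ≤ e_i ≤ L⁻¹` (`L > 0`): the matrices `diag((e_i, 1))` and their inverses are continuous images
of the compact box `[L, L⁻¹]ⁿ`. [folklore] -/
theorem exists_isCompact_forall_posRealDiagonal_mem {L : ℝ} (hL : 0 < L) :
    ∃ D : Set (GL (Fin n) (AdeleRing (𝓞 K) K)), IsCompact D ∧
      ∀ e : Fin n → ℝ≥0ˣ, (∀ i, L ≤ ((e i : ℝ≥0) : ℝ) ∧ ((e i : ℝ≥0) : ℝ) ≤ L⁻¹) →
        posRealDiagonal n K e ∈ D := by
  haveI : T2Space (AdeleRing (𝓞 K) K) := t2Space_adeleRing_aux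
  set Φ : (Fin n → ℝ) → Matrix (Fin n) (Fin n) (AdeleRing (𝓞 K) K) := fun x =>
    Matrix.diagonal fun i => realAdele K (x i) with hΦ
  have hΦc : Continuous Φ :=
    (continuous_pi fun i => (continuous_realAdele K).comp (continuous_apply i)).matrix_diagonal
  set Bx : Set (Fin n → ℝ) := Set.pi Set.univ fun _ => Icc L L⁻¹ with hBx
  have hBxc : IsCompact Bx := isCompact_univ_pi fun _ => isCompact_Icc
  have hval : ∀ e : Fin n → ℝ≥0ˣ, ((posRealDiagonal n K e : GL (Fin n) (AdeleRing (𝓞 K) K)) :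
      Matrix (Fin n) (Fin n) (AdeleRing (𝓞 K) K)) = Φ (fun i => ((e i : ℝ≥0) : ℝ)) := by
    intro e
    simp only [hΦ, coe_posRealDiagonal, coe_posRealIdele]
  set S : Set (GL (Fin n) (AdeleRing (𝓞 K) K)) := {g | ∃ e : Fin n → ℝ≥0ˣ,
      (∀ i, L ≤ ((e i : ℝ≥0) : ℝ) ∧ ((e i : ℝ≥0) : ℝ) ≤ L⁻¹) ∧ g = posRealDiagonal n K e}
    with hSdef
  have hS₁ : ∀ g ∈ S, (g : Matrix (Fin n) (Fin n) (AdeleRing (𝓞 K) K)) ∈ Φ '' Bx := by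
    rintro _ ⟨e, he, rfl⟩
    rw [hval]
    exact Set.mem_image_of_mem Φ (Set.mem_univ_pi.2 fun i => ⟨(he i).1, (he i).2⟩)
  have hS₂ : ∀ g ∈ S, ((g⁻¹ : GL (Fin n) (AdeleRing (𝓞 K) K)) :
      Matrix (Fin n) (Fin n) (AdeleRing (𝓞 K) K)) ∈ Φ '' Bx := by
    rintro _ ⟨e, he, rfl⟩
    rw [← map_inv, hval]
    refine Set.mem_image_of_mem Φ (Set.mem_univ_pi.2 fun i => ?_)
    have h1 := (he i).1
    have h2 := (he i).2
    have hei : 0 < ((e i : ℝ≥0) : ℝ) := lt_of_lt_of_le hL h1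
    rw [Pi.inv_apply, Units.val_inv_eq_inv_val, NNReal.coe_inv]
    refine ⟨?_, inv_anti₀ hL h1⟩
    have h := inv_anti₀ hei h2
    rwa [inv_inv] at h
  obtain ⟨D, hDc, hDsub⟩ := Units.exists_isCompact_superset_of_val_of_inv
    (hBxc.image hΦc) (hBxc.image hΦc) hS₁ hS₂
  exact ⟨D, hDc, fun e he => hDsub ⟨e, he, rfl⟩⟩

/-- **The Siegel property of Siegel sets in `GL_n(𝔸_K)` holds** (Borel; Godement, Sém. Bourbaki
257, §10, Théorème 9): discharge of the named fact `siegelFiniteness_gl n K`. For Siegel sets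
`S = Ω A_{T₀}(t) K`, `S' = Ω' A_{T₀}(t') K` only finitely many rational `γ` have
`γ A_G S ∩ S' ≠ ∅`.

Proof (Godement's Lemmes 1–4 made explicit for `GL_n`; no Bruhat decomposition is needed). From
`γ z ω a k = ω' a' k'` one gets `γ = a' ψ (z a)⁻¹` with `ψ = (a'⁻¹ω'a')(k'k⁻¹)(a⁻¹ω⁻¹a)` in a
fixed compact set `Ψ` (conjugation by the cone keeps compact subsets of `B(𝔸_K)` bounded,
`exists_isCompact_conj_siegelCone_mem_of_subset` — Lemme 1). By the product formula the rational
entries `γ_{ij} = (a'_i/(z a)_j, 1) ψ_{ij}` vanish where `a'_i/(z a)_j ≤ ε`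
(`exists_pos_forall_apply_eq_zero_of_map_eq_twoTorus` — Lemmes 2–3), and likewise for `γ⁻¹`; since
`γ` is invertible some permutation pattern survives (`exists_perm_forall_apply_ne_zero`), and a
pigeonhole on the cone (`siegelCone_le_of_perm_dominates`) gives `a' ≍ z a` componentwise, so that
`γ ∈ a Ψ₁ a⁻¹` with `Ψ₁` compact. Grouping the indices by the large gaps of `a` (`gapLabel`,
`SiegelMultiplicity`), the contraction lemma (`RationalPointsConeConjugates`) puts `γ` in the
standard parabolic `P_c(K)` — Lemme 3/4 — and then `k'k⁻¹ ∈ K ∩ P_c(𝔸_K)`; its archimedean part is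
unitary and block triangular, hence block diagonal (the maximal compact subgroup is *adapted* to
the diagonal torus, Godement's closing argument), while its finite part commutes with the
archimedean torus. Hence `γ ∈ Ω̄' · D · T_c · ({1} × GL_n(𝒪̂_K)) · Ω̄⁻¹`, a compact set, and
`GL_n(K)` is discrete (`gl_isDiscreteRational_holds`).
[cite: BorelEtAl2020, Godement Sém. Bourbaki 257 §10 Thm. 9 (PDF p. 170)] -/
theorem siegelFiniteness_gl_holds : siegelFiniteness_gl n K := by
  haveI : T2Space (GL (Fin n) (AdeleRing (𝓞 K) K)) := t2Space_gl n K
  haveI : T2Space (AdeleRing (𝓞 K) K) := t2Space_adeleRing_aux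
  intro S S' hS hS'
  obtain ⟨Ω, t, ht, hΩ, hΩc, rfl⟩ := hS
  obtain ⟨Ω', t', ht', hΩ', hΩ'c, rfl⟩ := hS'
  -- a common cone parameter `t₀ ≤ 1`
  set t₀ : ℝ := min (min t t') 1 with ht₀def
  have ht₀ : 0 < t₀ := lt_min (lt_min ht ht') one_pos
  have ht₀1 : t₀ ≤ 1 := min_le_right _ _
  have ht₀t : t₀ ≤ t := (min_le_left _ _).trans (min_le_left _ _)
  have ht₀t' : t₀ ≤ t' := (min_le_left _ _).trans (min_le_right _ _)
  -- the closures of `Ω`, `Ω'` are compact subsets of `B(𝔸_K)`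
  have hclΩ : closure Ω ⊆ (standardParabolicGL (AdeleRing (𝓞 K) K) (id : Fin n → Fin n) :
      Set (GL (Fin n) (AdeleRing (𝓞 K) K))) :=
    closure_minimal (hΩ.trans upperUnitriangular_mul_normOneDiagonal_subset)
      isClosed_standardParabolicGL_id
  have hclΩ' : closure Ω' ⊆ (standardParabolicGL (AdeleRing (𝓞 K) K) (id : Fin n → Fin n) :
      Set (GL (Fin n) (AdeleRing (𝓞 K) K))) :=
    closure_minimal (hΩ'.trans upperUnitriangular_mul_normOneDiagonal_subset)
      isClosed_standardParabolicGL_id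
  have hclΩinv : (closure Ω)⁻¹ ⊆ (standardParabolicGL (AdeleRing (𝓞 K) K) (id : Fin n → Fin n) :
      Set (GL (Fin n) (AdeleRing (𝓞 K) K))) := by
    intro b hb
    have h := hclΩ (Set.mem_inv.1 hb)
    simpa using Subgroup.inv_mem _ h
  -- Lemme 1: conjugation by the cone
  obtain ⟨C, hCc, hC⟩ := exists_isCompact_conj_siegelCone_mem_of_subset ht₀ hclΩinv hΩc.inv
  obtain ⟨C', hC'c, hC'⟩ := exists_isCompact_conj_siegelCone_mem_of_subset ht₀ hclΩ' hΩ'c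
  have hKc : IsCompact (standardMaximalCompactGL n K : Set (GL (Fin n) (AdeleRing (𝓞 K) K))) :=
    isCompact_standardMaximalCompactGL n K
  set Ψ : Set (GL (Fin n) (AdeleRing (𝓞 K) K)) :=
    C' * (standardMaximalCompactGL n K : Set (GL (Fin n) (AdeleRing (𝓞 K) K))) * C with hΨdef
  have hΨc : IsCompact Ψ := (hC'c.mul hKc).mul hCc
  have hΨsc : IsCompact (Ψ ∪ Ψ⁻¹) := hΨc.union hΨc.inv
  -- Lemmes 2–3: the vanishing constant
  obtain ⟨ε, hε, hvan⟩ := exists_pos_forall_apply_eq_zero_of_map_eq_twoTorus (K := K) hΨsc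
  set L : ℝ := ε * (t₀ ^ n * t₀ ^ n) with hLdef
  have hL : 0 < L := mul_pos hε (mul_pos (pow_pos ht₀ n) (pow_pos ht₀ n))
  obtain ⟨D, hDc, hD⟩ := exists_isCompact_forall_posRealDiagonal_mem (n := n) (K := K) hL
  set Ψ₁ : Set (GL (Fin n) (AdeleRing (𝓞 K) K)) := D * Ψ with hΨ₁def
  have hΨ₁c : IsCompact Ψ₁ := hDc.mul hΨc
  -- the contraction constant and the gap threshold
  obtain ⟨ε₁, hε₁, hpar⟩ := exists_pos_forall_mem_standardParabolicGL_of_map_eq_conj (K := K) hΨ₁c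
  set M : ℝ := max 1 (ε₁⁻¹ * t₀⁻¹ ^ n) with hMdef
  have hM1 : 1 ≤ M := le_max_left _ _
  have hMε : ε₁⁻¹ * t₀⁻¹ ^ n ≤ M := le_max_right _ _
  set Rb : ℝ := (max M t₀⁻¹) ^ n with hRbdef
  have hRb0 : 0 ≤ Rb := pow_nonneg (le_trans zero_le_one (hM1.trans (le_max_left _ _))) _
  -- the compact sets `T_c` of conjugates of block diagonal elements of `K_∞`
  set Box : Set (Fin n → Fin n → ℝ) := Set.pi Set.univ fun _ => Set.pi Set.univ fun _ => Icc 0 Rb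
    with hBoxdef
  have hBoxc : IsCompact Box := isCompact_univ_pi fun _ => isCompact_univ_pi fun _ => isCompact_Icc
  set KA : Set (GL (Fin n) (AdeleRing (𝓞 K) K)) :=
    (((Kinf n K).map (GLn.ofInfinite n K) : Subgroup (GL (Fin n) (AdeleRing (𝓞 K) K))) :
      Set (GL (Fin n) (AdeleRing (𝓞 K) K))) with hKAdef
  have hKAc : IsCompact KA := by
    rw [hKAdef, Subgroup.coe_map]
    exact (isCompact_Kinf_holds n K).image (GLn.continuous_ofInfinite n K)
  set V : Set (Matrix (Fin n) (Fin n) (AdeleRing (𝓞 K) K)) := Units.val '' KA with hVdef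
  have hVc : IsCompact V := hKAc.image Units.continuous_val
  have hT : ∀ c : Fin n → Fin (n + 1), ∃ T : Set (GL (Fin n) (AdeleRing (𝓞 K) K)), IsCompact T ∧
      {g : GL (Fin n) (AdeleRing (𝓞 K) K) |
        (g : Matrix (Fin n) (Fin n) (AdeleRing (𝓞 K) K)) ∈ leviBlockScale c '' (Box ×ˢ V) ∧
        ((g⁻¹ : GL (Fin n) (AdeleRing (𝓞 K) K)) : Matrix (Fin n) (Fin n) (AdeleRing (𝓞 K) K)) ∈
          leviBlockScale c '' (Box ×ˢ V)} ⊆ T := fun c =>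
    Units.exists_isCompact_superset_of_val_of_inv
      ((hBoxc.prod hVc).image (continuous_leviBlockScale c))
      ((hBoxc.prod hVc).image (continuous_leviBlockScale c)) (fun g hg => hg.1) (fun g hg => hg.2)
  choose T hTc hTsub using hT
  have hK₂c : IsCompact (glIntegralLevel n K : Set (GL (Fin n) (AdeleRing (𝓞 K) K))) :=
    isCompact_glIntegralLevel_holds n K
  -- the compact set containing all the `γ`
  set Γc : Set (GL (Fin n) (AdeleRing (𝓞 K) K)) :=
    closure Ω' * D * (⋃ c, T c) * (glIntegralLevel n K : Set (GL (Fin n) (AdeleRing (𝓞 K) K))) *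
      (closure Ω)⁻¹ with hΓcdef
  have hΓcc : IsCompact Γc :=
    (((hΩ'c.mul hDc).mul (isCompact_iUnion fun c => hTc c)).mul hK₂c).mul hΩc.inv
  -- rational points of `Γc` are finite in number
  set Γ : Subgroup (GL (Fin n) (AdeleRing (𝓞 K) K)) := rationalPointsGL n K with hΓ
  have hΓclosed : IsClosed (Γ : Set (GL (Fin n) (AdeleRing (𝓞 K) K))) :=
    isClosed_arithmeticSubgroup_gl n K
  haveI hΓdisc : DiscreteTopology ↥Γ := gl_isDiscreteRational_holds n K
  set Fset : Set (GL (Fin n) (AdeleRing (𝓞 K) K)) :=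
    (Γ : Set (GL (Fin n) (AdeleRing (𝓞 K) K))) ∩ Γc with hFset
  have hFdisc : DiscreteTopology ↥Fset := DiscreteTopology.of_subset hΓdisc inter_subset_left
  have hFfin : Fset.Finite :=
    (hΓcc.inter_left hΓclosed).finite (isDiscrete_iff_discreteTopology.2 hFdisc)
  refine hFfin.subset ?_
  -- the main inclusion
  rintro γ ⟨hγ, z, hz, s, hs, hγzs⟩
  refine ⟨hγ, ?_⟩
  obtain ⟨_, ⟨ω, hω, a, ha, rfl⟩, k, hk, rfl⟩ := hs
  obtain ⟨_, ⟨ω', hω', a', ha', rfl⟩, k', hk', he⟩ := hγzs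
  obtain ⟨α, hαprod, hαroot, rfl⟩ := ha
  obtain ⟨α', hα'prod, hα'root, rfl⟩ := ha'
  obtain ⟨r, rfl⟩ := hz
  obtain ⟨γ₀, rfl⟩ := hγ
  -- root inequalities for `t₀`
  have hα₀ : ∀ i j : Fin n, (j : ℕ) = (i : ℕ) + 1 →
      t₀ * ((α j : ℝ≥0) : ℝ) ≤ ((α i : ℝ≥0) : ℝ) := fun i j hij =>
    (mul_le_mul_of_nonneg_right ht₀t (NNReal.coe_nonneg _)).trans (hαroot i j hij)
  have hα'₀ : ∀ i j : Fin n, (j : ℕ) = (i : ℕ) + 1 →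
      t₀ * ((α' j : ℝ≥0) : ℝ) ≤ ((α' i : ℝ≥0) : ℝ) := fun i j hij =>
    (mul_le_mul_of_nonneg_right ht₀t' (NNReal.coe_nonneg _)).trans (hα'root i j hij)
  set β : Fin n → ℝ≥0ˣ := fun i => r * α i with hβdef
  have hβ₀ : ∀ i j : Fin n, (j : ℕ) = (i : ℕ) + 1 →
      t₀ * ((β j : ℝ≥0) : ℝ) ≤ ((β i : ℝ≥0) : ℝ) := by
    intro i j hij
    have h := mul_le_mul_of_nonneg_left (hα₀ i j hij) (NNReal.coe_nonneg (r : ℝ≥0))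
    simp only [hβdef, Units.val_mul, NNReal.coe_mul]
    calc t₀ * (((r : ℝ≥0) : ℝ) * ((α j : ℝ≥0) : ℝ)) = ((r : ℝ≥0) : ℝ) * (t₀ * ((α j : ℝ≥0) : ℝ)) := by
          ring
      _ ≤ ((r : ℝ≥0) : ℝ) * ((α i : ℝ≥0) : ℝ) := h
  have ha₀ : posRealDiagonal n K α ∈ siegelCone n K t₀ := ⟨α, hαprod, hα₀, rfl⟩
  have ha'₀ : posRealDiagonal n K α' ∈ siegelCone n K t₀ := ⟨α', hα'prod, hα'₀, rfl⟩
  have hzβ : posRealScalar n K r * posRealDiagonal n K α = posRealDiagonal n K β := by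
    rw [posRealScalar_eq_posRealDiagonal_const, ← map_mul]
    rfl
  -- the centre is central
  have hzc : ∀ g : GL (Fin n) (AdeleRing (𝓞 K) K),
      (posRealScalar n K r)⁻¹ * g = g * (posRealScalar n K r)⁻¹ := fun g =>
    posRealScalar_range_comm (inv_mem ⟨r, rfl⟩) g
  -- Lemme 1: the compact pieces
  have hc₁ : (posRealDiagonal n K α')⁻¹ * ω' * posRealDiagonal n K α' ∈ C' :=
    hC' _ ha'₀ ω' (subset_closure hω')
  have hc₂ : (posRealDiagonal n K α)⁻¹ * ω⁻¹ * posRealDiagonal n K α ∈ C :=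
    hC _ ha₀ ω⁻¹ (Set.inv_mem_inv.2 (subset_closure hω))
  have hκK : k' * k⁻¹ ∈ standardMaximalCompactGL n K := mul_mem hk' (inv_mem hk)
  set ψ : GL (Fin n) (AdeleRing (𝓞 K) K) :=
    (posRealDiagonal n K α')⁻¹ * ω' * posRealDiagonal n K α' * (k' * k⁻¹) *
      ((posRealDiagonal n K α)⁻¹ * ω⁻¹ * posRealDiagonal n K α) with hψdef
  have hψ : ψ ∈ Ψ := Set.mul_mem_mul (Set.mul_mem_mul hc₁ hκK) hc₂
  -- `γ = a' ψ (z a)⁻¹`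
  have h2 : (Matrix.GeneralLinearGroup.map (algebraMap K (AdeleRing (𝓞 K) K)) γ₀ :
      GL (Fin n) (AdeleRing (𝓞 K) K)) =
      ω' * posRealDiagonal n K α' * k' * (ω * posRealDiagonal n K α * k)⁻¹ *
        (posRealScalar n K r)⁻¹ :=
    eq_mul_inv_of_mul_eq (eq_mul_inv_of_mul_eq he.symm)
  have hI1 : (Matrix.GeneralLinearGroup.map (algebraMap K (AdeleRing (𝓞 K) K)) γ₀ :
      GL (Fin n) (AdeleRing (𝓞 K) K)) =
      posRealDiagonal n K α' * ψ * (posRealDiagonal n K β)⁻¹ := by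
    rw [← hzβ, h2, hψdef]
    group
  have hI1' : (Matrix.GeneralLinearGroup.map (algebraMap K (AdeleRing (𝓞 K) K)) γ₀⁻¹ :
      GL (Fin n) (AdeleRing (𝓞 K) K)) =
      posRealDiagonal n K β * ψ⁻¹ * (posRealDiagonal n K α')⁻¹ := by
    rw [map_inv, hI1]
    simp only [mul_inv_rev, inv_inv, mul_assoc]
  -- Lemmes 2–3 and the pigeonhole: `a' ≍ z a`
  obtain ⟨σ, hσ⟩ := exists_perm_forall_apply_ne_zero γ₀
  obtain ⟨τ, hτ⟩ := exists_perm_forall_apply_ne_zero γ₀⁻¹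
  have hβpos : ∀ i, 0 < ((β i : ℝ≥0) : ℝ) := fun i =>
    NNReal.coe_pos.2 (pos_iff_ne_zero.2 (β i).ne_zero)
  have hα'pos : ∀ i, 0 < ((α' i : ℝ≥0) : ℝ) := fun i =>
    NNReal.coe_pos.2 (pos_iff_ne_zero.2 (α' i).ne_zero)
  have hdom : ∀ i, ε * ((β i : ℝ≥0) : ℝ) ≤ ((α' (σ i) : ℝ≥0) : ℝ) := by
    intro i
    have hlt : ¬ (((α' (σ i) : ℝ≥0) : ℝ) / ((β i : ℝ≥0) : ℝ) ≤ ε) := fun hle =>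
      hσ i (hvan α' β γ₀ ψ (Or.inl hψ) hI1 (σ i) i hle)
    rw [not_le, lt_div_iff₀ (hβpos i)] at hlt
    exact hlt.le
  have hdom' : ∀ i, ε * ((α' i : ℝ≥0) : ℝ) ≤ ((β (τ i) : ℝ≥0) : ℝ) := by
    intro i
    have hlt : ¬ (((β (τ i) : ℝ≥0) : ℝ) / ((α' i : ℝ≥0) : ℝ) ≤ ε) := fun hle =>
      hτ i (hvan β α' γ₀⁻¹ ψ⁻¹ (Or.inr (Set.inv_mem_inv.2 hψ)) hI1' (τ i) i hle)
    rw [not_le, lt_div_iff₀ (hα'pos i)] at hlt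
    exact hlt.le
  have hge : ∀ j, L * ((β j : ℝ≥0) : ℝ) ≤ ((α' j : ℝ≥0) : ℝ) := fun j =>
    siegelCone_le_of_perm_dominates ht₀ ht₀1 hε.le hα'₀ hβ₀ σ hdom j
  have hle : ∀ j, L * ((α' j : ℝ≥0) : ℝ) ≤ ((β j : ℝ≥0) : ℝ) := fun j =>
    siegelCone_le_of_perm_dominates ht₀ ht₀1 hε.le hβ₀ hα'₀ τ hdom' j
  -- the bounded torus element `e = a' (z a)⁻¹`
  set e : Fin n → ℝ≥0ˣ := fun i => α' i * (β i)⁻¹ with hedef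
  have hecoe : ∀ i, ((e i : ℝ≥0) : ℝ) = ((α' i : ℝ≥0) : ℝ) / ((β i : ℝ≥0) : ℝ) := fun i => by
    simp only [hedef, Units.val_mul, Units.val_inv_eq_inv_val, NNReal.coe_mul, NNReal.coe_inv,
      div_eq_mul_inv]
  have hebd : ∀ i, L ≤ ((e i : ℝ≥0) : ℝ) ∧ ((e i : ℝ≥0) : ℝ) ≤ L⁻¹ := by
    intro i
    rw [hecoe]
    refine ⟨(le_div_iff₀ (hβpos i)).2 (hge i), (div_le_iff₀ (hβpos i)).2 ?_⟩
    calc ((α' i : ℝ≥0) : ℝ) = L⁻¹ * (L * ((α' i : ℝ≥0) : ℝ)) := by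
          rw [← mul_assoc, inv_mul_cancel₀ hL.ne', one_mul]
      _ ≤ L⁻¹ * ((β i : ℝ≥0) : ℝ) := mul_le_mul_of_nonneg_left (hle i) (inv_nonneg.2 hL.le)
  have heD : posRealDiagonal n K e ∈ D := hD e hebd
  have hed : posRealDiagonal n K e = posRealDiagonal n K α' * (posRealDiagonal n K β)⁻¹ := by
    rw [← map_inv, ← map_mul]
    rfl
  -- `γ = a ψ₁ a⁻¹` with `ψ₁ = e ψ ∈ Ψ₁`
  have hψ₁ : posRealDiagonal n K e * ψ ∈ Ψ₁ := Set.mul_mem_mul heD hψ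
  have hzcomm : (posRealDiagonal n K fun _ : Fin n => r)⁻¹ * ψ =
      ψ * (posRealDiagonal n K fun _ : Fin n => r)⁻¹ := by
    rw [← posRealScalar_eq_posRealDiagonal_const]
    exact hzc ψ
  have hI2 : (Matrix.GeneralLinearGroup.map (algebraMap K (AdeleRing (𝓞 K) K)) γ₀ :
      GL (Fin n) (AdeleRing (𝓞 K) K)) =
      posRealDiagonal n K α * (posRealDiagonal n K e * ψ) * (posRealDiagonal n K α)⁻¹ := by
    have hαe : α * e = α' * (fun _ : Fin n => r)⁻¹ := by
      funext i
      simp only [Pi.mul_apply, Pi.inv_apply, hedef, hβdef]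
      rw [mul_inv_rev, mul_left_comm, mul_inv_cancel_left]
    have hβ' : β = α * (fun _ : Fin n => r) := by
      funext i
      simp only [Pi.mul_apply, hβdef]
      rw [mul_comm]
    rw [hI1]
    symm
    calc posRealDiagonal n K α * (posRealDiagonal n K e * ψ) * (posRealDiagonal n K α)⁻¹
        = posRealDiagonal n K (α * e) * ψ * (posRealDiagonal n K α)⁻¹ := by
          rw [map_mul]; simp only [mul_assoc]
      _ = posRealDiagonal n K α' * ((posRealDiagonal n K fun _ : Fin n => r)⁻¹ * ψ) *
          (posRealDiagonal n K α)⁻¹ := by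
          rw [hαe, map_mul, map_inv]; simp only [mul_assoc]
      _ = posRealDiagonal n K α' * ψ * (posRealDiagonal n K β)⁻¹ := by
          rw [hzcomm, hβ', map_mul, mul_inv_rev]; simp only [mul_assoc]
  -- Lemme 3/4: `γ ∈ P_c(K)` for the gap labelling `c` of `a`
  set cl : Fin n → Fin (n + 1) := gapLabel α M with hcldef
  have hclmono : Monotone cl := monotone_gapLabel α M
  have hcontr : ∀ i j : Fin n, cl j < cl i → ((α i : ℝ≥0) : ℝ) / ((α j : ℝ≥0) : ℝ) ≤ ε₁ :=
    fun i j hij => div_le_of_gapLabel_lt ht₀ ht₀1 hε₁ hMε hα₀ hij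
  have hγP : γ₀ ∈ standardParabolicGL K cl :=
    hpar cl α hcontr γ₀ (posRealDiagonal n K e * ψ) hψ₁ hI2
  -- `κ = k' k⁻¹ ∈ K ∩ P_c(𝔸_K)`
  have hBP : standardParabolicGL (AdeleRing (𝓞 K) K) (id : Fin n → Fin n) ≤
      standardParabolicGL (AdeleRing (𝓞 K) K) cl := fun _ hg =>
    (mem_standardParabolicGL_iff _ _).2
      (blockTriangular_of_blockTriangular_id_of_monotone ((mem_standardParabolicGL_iff _ _).1 hg)
        hclmono)
  have hdiagP : ∀ d : Fin n → ℝ≥0ˣ,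
      posRealDiagonal n K d ∈ standardParabolicGL (AdeleRing (𝓞 K) K) cl := fun d => by
    rw [mem_standardParabolicGL_iff, coe_posRealDiagonal]
    exact Matrix.blockTriangular_diagonal _
  have hzP : posRealScalar n K r ∈ standardParabolicGL (AdeleRing (𝓞 K) K) cl := by
    rw [posRealScalar_eq_posRealDiagonal_const]
    exact hdiagP _
  have hω'B : ω' ∈ standardParabolicGL (AdeleRing (𝓞 K) K) (id : Fin n → Fin n) :=
    hclΩ' (subset_closure hω')
  have hωB : ω ∈ standardParabolicGL (AdeleRing (𝓞 K) K) (id : Fin n → Fin n) :=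
    hclΩ (subset_closure hω)
  have hκeq : k' * k⁻¹ =
      ((posRealDiagonal n K α')⁻¹ * ω' * posRealDiagonal n K α')⁻¹ *
        ((posRealDiagonal n K α')⁻¹ *
          ((Matrix.GeneralLinearGroup.map (algebraMap K (AdeleRing (𝓞 K) K)) γ₀ :
            GL (Fin n) (AdeleRing (𝓞 K) K)) * posRealScalar n K r) * posRealDiagonal n K α) *
        ((posRealDiagonal n K α)⁻¹ * ω⁻¹ * posRealDiagonal n K α)⁻¹ := by
    rw [h2]
    group
  have hc₁B : (posRealDiagonal n K α')⁻¹ * ω' * posRealDiagonal n K α' ∈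
      standardParabolicGL (AdeleRing (𝓞 K) K) (id : Fin n → Fin n) :=
    mul_mem (mul_mem (inv_mem (posRealDiagonal_mem_standardParabolicGL α')) hω'B)
      (posRealDiagonal_mem_standardParabolicGL α')
  have hc₂B : (posRealDiagonal n K α)⁻¹ * ω⁻¹ * posRealDiagonal n K α ∈
      standardParabolicGL (AdeleRing (𝓞 K) K) (id : Fin n → Fin n) :=
    mul_mem (mul_mem (inv_mem (posRealDiagonal_mem_standardParabolicGL α)) (inv_mem hωB))
      (posRealDiagonal_mem_standardParabolicGL α)
  have hκP : k' * k⁻¹ ∈ standardParabolicGL (AdeleRing (𝓞 K) K) cl := by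
    rw [hκeq]
    exact mul_mem (mul_mem (inv_mem (hBP hc₁B)) (mul_mem (mul_mem (inv_mem (hdiagP α'))
      (mul_mem (map_mem_standardParabolicGL_of_mem _ cl hγP) hzP)) (hdiagP α))) (inv_mem (hBP hc₂B))
  -- the archimedean part of `κ` is block diagonal (`M_∞` adapted to the torus)
  obtain ⟨g, hg, k₂, hk₂, hk, hoff, hoffinv⟩ :=
    exists_ofInfinite_mul_of_mem_standardParabolicGL cl hκK hκP
  have hκ₁KA : GLn.ofInfinite n K g ∈ KA := ⟨g, hg, rfl⟩
  have hκ₁invKA : (GLn.ofInfinite n K g)⁻¹ ∈ KA := by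
    rw [← map_inv]
    exact ⟨g⁻¹, inv_mem hg, rfl⟩
  -- in-block ratios of `a` are bounded
  set ρ : Fin n → Fin n → ℝ := fun i j =>
    if cl i = cl j then ((α i : ℝ≥0) : ℝ) / ((α j : ℝ≥0) : ℝ) else 0 with hρdef
  have hρB : ρ ∈ Box := by
    simp only [hBoxdef, Set.mem_pi, Set.mem_univ, forall_true_left, Set.mem_Icc]
    intro i j
    by_cases hij : cl i = cl j
    · simp only [hρdef, if_pos hij]
      have hαj : 0 < ((α j : ℝ≥0) : ℝ) := NNReal.coe_pos.2 (pos_iff_ne_zero.2 (α j).ne_zero)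
      refine ⟨by positivity, ?_⟩
      rw [div_le_iff₀ hαj]
      exact apply_le_of_gapLabel_eq ht₀ ht₀1 hM1 hα₀ hij
    · simp only [hρdef, if_neg hij]
      exact ⟨le_rfl, hRb0⟩
  -- the conjugate `a κ₁ a⁻¹` of the archimedean part and its inverse are block-scaled matrices
  have hval1 : ((posRealDiagonal n K α * GLn.ofInfinite n K g * (posRealDiagonal n K α)⁻¹ :
      GL (Fin n) (AdeleRing (𝓞 K) K)) : Matrix (Fin n) (Fin n) (AdeleRing (𝓞 K) K)) =
      leviBlockScale cl (ρ, ((GLn.ofInfinite n K g : GL (Fin n) (AdeleRing (𝓞 K) K)) :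
        Matrix (Fin n) (Fin n) (AdeleRing (𝓞 K) K))) := by
    ext i j
    rw [coe_posRealDiagonal_mul_mul_inv_apply]
    simp only [leviBlockScale, Matrix.of_apply, hρdef]
    by_cases hij : cl i = cl j
    · rw [if_pos hij, if_pos hij]
    · rw [if_neg hij, hoff i j hij, mul_zero]
  have hinvconj : (posRealDiagonal n K α * GLn.ofInfinite n K g * (posRealDiagonal n K α)⁻¹)⁻¹ =
      posRealDiagonal n K α * (GLn.ofInfinite n K g)⁻¹ * (posRealDiagonal n K α)⁻¹ := by
    simp only [mul_inv_rev, inv_inv, mul_assoc]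
  have hval2 : (((posRealDiagonal n K α * GLn.ofInfinite n K g * (posRealDiagonal n K α)⁻¹)⁻¹ :
      GL (Fin n) (AdeleRing (𝓞 K) K)) : Matrix (Fin n) (Fin n) (AdeleRing (𝓞 K) K)) =
      leviBlockScale cl (ρ, (((GLn.ofInfinite n K g)⁻¹ : GL (Fin n) (AdeleRing (𝓞 K) K)) :
        Matrix (Fin n) (Fin n) (AdeleRing (𝓞 K) K))) := by
    rw [hinvconj]
    ext i j
    rw [coe_posRealDiagonal_mul_mul_inv_apply]
    simp only [leviBlockScale, Matrix.of_apply, hρdef]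
    by_cases hij : cl i = cl j
    · rw [if_pos hij, if_pos hij]
    · rw [if_neg hij, hoffinv i j hij, mul_zero]
  have hTmem : posRealDiagonal n K α * GLn.ofInfinite n K g * (posRealDiagonal n K α)⁻¹ ∈ T cl :=
    hTsub cl ⟨⟨(ρ, ((GLn.ofInfinite n K g : GL (Fin n) (AdeleRing (𝓞 K) K)) :
        Matrix (Fin n) (Fin n) (AdeleRing (𝓞 K) K))),
      Set.mk_mem_prod hρB (Set.mem_image_of_mem _ hκ₁KA), hval1.symm⟩,
      ⟨(ρ, (((GLn.ofInfinite n K g)⁻¹ : GL (Fin n) (AdeleRing (𝓞 K) K)) :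
        Matrix (Fin n) (Fin n) (AdeleRing (𝓞 K) K))),
      Set.mk_mem_prod hρB (Set.mem_image_of_mem _ hκ₁invKA), hval2.symm⟩⟩
  -- the finite part commutes with the archimedean torus
  have hk₂conj : posRealDiagonal n K α * k₂ * (posRealDiagonal n K α)⁻¹ = k₂ :=
    posRealDiagonal_mul_mul_inv_eq_of_mem_glIntegralLevel α hk₂
  -- the final identity `γ = ω' · e · (a κ₁ a⁻¹) · k₂ · ω⁻¹`
  have hkk : posRealDiagonal n K α * GLn.ofInfinite n K g * (posRealDiagonal n K α)⁻¹ *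
      (posRealDiagonal n K α * k₂ * (posRealDiagonal n K α)⁻¹) =
      posRealDiagonal n K α * (k' * k⁻¹) * (posRealDiagonal n K α)⁻¹ := by
    rw [hk]
    group
  have hfinal : (Matrix.GeneralLinearGroup.map (algebraMap K (AdeleRing (𝓞 K) K)) γ₀ :
      GL (Fin n) (AdeleRing (𝓞 K) K)) =
      ω' * posRealDiagonal n K e *
        (posRealDiagonal n K α * GLn.ofInfinite n K g * (posRealDiagonal n K α)⁻¹) * k₂ * ω⁻¹ := by
    rw [hed, ← hzβ]
    conv_rhs => rw [← hk₂conj]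
    rw [mul_assoc (ω' * (posRealDiagonal n K α' * (posRealScalar n K r * posRealDiagonal n K α)⁻¹))
      (posRealDiagonal n K α * GLn.ofInfinite n K g * (posRealDiagonal n K α)⁻¹), hkk]
    calc (Matrix.GeneralLinearGroup.map (algebraMap K (AdeleRing (𝓞 K) K)) γ₀ :
          GL (Fin n) (AdeleRing (𝓞 K) K))
        = ω' * posRealDiagonal n K α' * k' * (ω * posRealDiagonal n K α * k)⁻¹ *
            (posRealScalar n K r)⁻¹ := h2
      _ = ω' * posRealDiagonal n K α' * (posRealDiagonal n K α)⁻¹ *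
            ((posRealDiagonal n K α * (k' * k⁻¹) * (posRealDiagonal n K α)⁻¹ * ω⁻¹) *
              (posRealScalar n K r)⁻¹) := by group
      _ = ω' * posRealDiagonal n K α' * (posRealDiagonal n K α)⁻¹ *
            ((posRealScalar n K r)⁻¹ *
              (posRealDiagonal n K α * (k' * k⁻¹) * (posRealDiagonal n K α)⁻¹ * ω⁻¹)) := by
          rw [hzc]
      _ = ω' * (posRealDiagonal n K α' * (posRealScalar n K r * posRealDiagonal n K α)⁻¹) *
            (posRealDiagonal n K α * (k' * k⁻¹) * (posRealDiagonal n K α)⁻¹) * ω⁻¹ := by group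
  rw [hfinal]
  exact Set.mul_mem_mul (Set.mul_mem_mul (Set.mul_mem_mul (Set.mul_mem_mul
    (subset_closure hω') heD) (Set.mem_iUnion.2 ⟨cl, hTmem⟩)) hk₂)
    (Set.inv_mem_inv.2 (subset_closure hω))

end Literature.NumberTheory.Automorphic
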